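import Summits.AtomisticToContinuum.Crystallization.Theorems.LayeredLawsSelectHcp.Negative.HcpShells
import Summits.AtomisticToContinuum.Crystallization.Theorems.LayeredLawsSelectHcp.Negative.PeriodicEnergy

/-!
# Negative knowledge for crux `LayeredLawsSelectHcp` (stmt-AtomisticToContinuum-9226), XIII:
# the intended model — H1, H2, H4 hold, H3 is `e(hcp) ≤ e*`, and the CONCLUSION holds

Part XIII (`--supports stmt-AtomisticToContinuum-9226`). For the ideal hcp `hcpQ ha` (=
`hcpPeriodicConfiguration` at `h = a√⅔`) and its Palm law `palmLaw (hcpQ ha)` (part VII):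
**`hcpPalm_hypotheses`** (H1 `a`-separated, H2, H4 for `a ∈ [9/10,1]`), `hcpPalm_energy_iff` (its H3 is the
lattice-sum inequality `e(hcp a (a√⅔)) ≤ e*`), **`crux_structural_hypotheses_satisfiable`** (H1 ∧ H2 ∧ H4 are
jointly satisfiable by a NON-lattice law — the crux is not vacuous through its structural hypotheses),
`hcpStacking_sub_b_eq_neg` (re-rooting hcp at a `B`-site is the point inversion), **`hcpPalm_conclusion`** (if
`e(hcp a (a√⅔)) = e*` the conclusion of the crux HOLDS for that law: the two views are `hcp` and `−hcp`,
`A = ±id`, `(a, a√⅔) ∈ [1/2,2]²`) and **`crux_consistent`**: modulo "ideal hcp at some admissible spacing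
minimises the Lennard-Jones energy per particle over periodic configurations" there is a law satisfying ALL
FOUR hypotheses for which the conclusion holds — the crux is exactly right on its intended witness. Together
with parts IV (H3 load-bearing), VIII (kill criteria) and IX (H1 redundant) this completes the standing
disprover's structural audit: the only non-formal content of the crux is the `~10⁻⁴|e*|` hcp-vs-all
comparison (items 0670/3063). All `[folklore]`.
-/

noncomputable section

namespace Summit.AtomisticToContinuum.Crystallization.Theorems.LayeredLawsSelectHcp.Negative.IntendedModel

open MeasureTheory Set
open Literature.MathematicalPhysics.StatisticalMechanics Literature.Geometry.DiscreteGeometry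
open Summit.AtomisticToContinuum.Crystallization.Theses.PalmUnimodularRigidity (LayeredLawsSelectHcp)
open Summit.AtomisticToContinuum.Crystallization.Theorems.ChargedEnergyGapNegative
  (eStar eStar_le bddBelow_energyPerParticle_lennardJones)
open Summit.AtomisticToContinuum.Crystallization.Theorems.LayeredLawsSelectHcp.Negative.DiracLaws
open Summit.AtomisticToContinuum.Crystallization.Theorems.LayeredLawsSelectHcp.Negative.IntegerForms
open Summit.AtomisticToContinuum.Crystallization.Theorems.LayeredLawsSelectHcp.Negative.IdealStackings
open Summit.AtomisticToContinuum.Crystallization.Theorems.LayeredLawsSelectHcp.Negative.HexCubic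
open Summit.AtomisticToContinuum.Crystallization.Theorems.LayeredLawsSelectHcp.Negative.HcpShells
open Summit.AtomisticToContinuum.Crystallization.Theorems.LayeredLawsSelectHcp.Negative.PeriodicPalmLaw
open Summit.AtomisticToContinuum.Crystallization.Theorems.LayeredLawsSelectHcp.Negative.PeriodicEnergy

/-- Euclidean `3`-space. [folklore] -/
local notation "E3" => EuclideanSpace ℝ (Fin 3)

/-! ## Consistency of the conclusion's shape: the view of hcp from a `B`-site is `−hcp` -/

/-- Re-rooting hcp at the `B`-site `b = w + h e₃` is the point inversion, index by index:
`barlowPos k i j − b = −barlowPos (1−k) (−i) (−j)` (layers `k` and `1 − k` have opposite parity,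
hence opposite letters). [folklore] -/
theorem barlowPos_alternating_sub_b (a h : ℝ) (k i j : ℤ) :
    barlowPos a h alternatingHagg k i j - barlowPos a h alternatingHagg 1 0 0 =
      -barlowPos a h alternatingHagg (1 - k) (-i) (-j) := by
  have hL1 : haggLabel alternatingHagg 1 = 1 := by rw [haggLabel_alternating]; decide
  have hpar : (haggLabel alternatingHagg k : ℝ) - 1 = -(haggLabel alternatingHagg (1 - k) : ℝ) := by
    rw [haggLabel_alternating, haggLabel_alternating]
    by_cases hk : Even k
    · have h1k : ¬ Even (1 - k) := fun h => Int.not_even_one ((Int.even_sub.1 h).2 hk)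
      simp [hk, h1k]
    · have h1k : Even (1 - k) := Int.even_sub.2 (iff_of_false Int.not_even_one hk)
      simp [hk, h1k]
  ext l
  fin_cases l <;> simp [hL1] <;>
    first
    | linear_combination (a / 2) * hpar
    | linear_combination (a * Real.sqrt 3 / 6) * hpar
    | ring

/-- **The `B`-rooted hcp is the inverted hcp**: `hcpStacking a h − b = −hcpStacking a h` for the
`B`-site `b = barlowPos a h alternatingHagg 1 0 0`. So the hcp Palm law is
`½ δ_{count|hcp} + ½ δ_{count|(−hcp)}` and the conclusion's `∃ A` is exercised with `A = ±id`
(for `a > 0`; note also `−hcpStacking a h = hcpStacking (−a) (−h)`-type identities). [folklore] -/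
theorem hcpStacking_sub_b_eq_neg (a h : ℝ) :
    (fun z => z - barlowPos a h alternatingHagg 1 0 0) '' hcpStacking a h =
      (fun z => -z) '' hcpStacking a h := by
  ext z
  simp only [Set.mem_image, hcpStacking, mem_barlowStacking_iff]
  constructor
  · rintro ⟨_, ⟨k, i, j, rfl⟩, rfl⟩
    exact ⟨_, ⟨1 - k, -i, -j, rfl⟩, (barlowPos_alternating_sub_b a h k i j).symm⟩
  · rintro ⟨_, ⟨k, i, j, rfl⟩, rfl⟩
    refine ⟨_, ⟨1 - k, -i, -j, rfl⟩, ?_⟩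
    have := barlowPos_alternating_sub_b a h (1 - k) (-i) (-j)
    simp only [sub_sub_cancel, neg_neg] at this
    exact this

/-! ## The intended model: the Palm law of ideal hcp satisfies H1, H2, H4, its H3 is
`e(hcp) ≤ e*`, and the conclusion HOLDS for it — the crux is consistent and non-vacuous modulo H3 -/

section IntendedModel

variable {a : ℝ}

/-- Non-vanishing of the ideal layer spacing. [folklore] -/
theorem idealRatio_ne_zero (ha : a ≠ 0) : a * Real.sqrt (2 / 3) ≠ 0 :=
  mul_ne_zero ha (by positivity)

/-- The ideal hcp of spacing `a` as a periodic configuration. [folklore] -/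
def hcpQ (ha : a ≠ 0) : PeriodicConfiguration 3 :=
  hcpPeriodicConfiguration ha (idealRatio_ne_zero ha)

/-- Its point set. [folklore] -/
theorem hcpQ_points (ha : a ≠ 0) : (hcpQ ha).points = hcpStacking a (a * Real.sqrt (2 / 3)) :=
  hcpPeriodicConfiguration_points ha _

/-- Its motif is `{0, b}`, `b = barlowPos a (a√⅔) alternatingHagg 1 0 0` the `B`-site. [folklore] -/
theorem mem_hcpQ_motif (ha : a ≠ 0) {x : E3} (hx : x ∈ (hcpQ ha).motif) :
    x = 0 ∨ x = barlowPos a (a * Real.sqrt (2 / 3)) alternatingHagg 1 0 0 := by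
  change x ∈ (Finset.range 2).image (fun m : ℕ => barlowPos a (a * Real.sqrt (2 / 3)) alternatingHagg m 0 0) at hx
  obtain ⟨m, hm, rfl⟩ := Finset.mem_image.1 hx
  rw [Finset.mem_range] at hm
  interval_cases m
  · left; ext l; fin_cases l <;> simp
  · right; rfl

/-- **The intended model satisfies H1, H2, H4** (ideal hcp, `a ∈ [9/10, 1]`). [folklore] -/
theorem hcpPalm_hypotheses (h9 : 9 / 10 ≤ a) (h1 : a ≤ 1) :
    IsProbabilityMeasure (palmLaw (hcpQ (show a ≠ 0 by intro h; rw [h] at h9; norm_num at h9))) ∧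
    Rooted a (palmLaw (hcpQ (show a ≠ 0 by intro h; rw [h] at h9; norm_num at h9))) ∧
    PointStationary (palmLaw (hcpQ (show a ≠ 0 by intro h; rw [h] at h9; norm_num at h9))) ∧
    Layered (palmLaw (hcpQ (show a ≠ 0 by intro h; rw [h] at h9; norm_num at h9))) := by
  have ha : 0 < a := by linarith
  set Q := hcpQ (show a ≠ 0 by intro h; rw [h] at h9; norm_num at h9) with hQ
  have hpts : Q.points = barlowStacking a (a * Real.sqrt (2 / 3)) alternatingHagg := hcpQ_points ha.ne'
  refine ⟨inferInstance, ?_, pointStationary_palmLaw Q, ?_⟩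
  · refine rooted_palmLaw Q fun p hp q hq hne => ?_
    rw [hpts] at hp hq
    exact le_dist_of_mem_barlowStacking_ideal isHaggSeq_alternating ha (idealRatio_sq a) hp hq hne
  · refine ae_palmLaw Q fun x _ => ⟨view Q x, rfl, ?_, ?_⟩
    · rintro _ ⟨p, hp, rfl⟩
      refine goodShell_image_sub x ?_
      rw [hpts] at hp ⊢
      exact goodShell_hcp_ideal h9 h1 hp
    · refine barlowLike_image_sub x ?_
      rw [hpts]
      exact barlowLike_barlowStacking_ideal isHaggSeq_alternating h9 h1

/-- **Its H3 is the lattice-sum inequality `e(hcp a (a√⅔)) ≤ e*`** (`meanRootEnergy_palmLaw`). [folklore] -/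
theorem hcpPalm_energy_iff (ha : a ≠ 0) :
    meanRootEnergy (palmLaw (hcpQ ha)) ≤ eStar ↔ (hcpQ ha).energyPerParticle lennardJones ≤ eStar := by
  rw [meanRootEnergy_palmLaw]

/-- **H1 ∧ H2 ∧ H4 are jointly satisfiable by a NON-lattice law** (the Palm law of ideal hcp at
`a = 1`): the crux is not vacuous through its structural hypotheses. [folklore] -/
theorem crux_structural_hypotheses_satisfiable :
    ∃ δ : ℝ, 0 < δ ∧ ∃ P : Measure (Measure E3), IsProbabilityMeasure P ∧ Rooted δ P ∧
      PointStationary P ∧ Layered P := by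
  obtain ⟨h0, h1, h2, h4⟩ := hcpPalm_hypotheses (a := 1) (by norm_num) le_rfl
  exact ⟨1, one_pos, _, h0, h1, h2, h4⟩

/-- `√(2/3) ∈ [4/5, 1]`. [folklore] -/
theorem sqrt_twoThirds_bounds : 4 / 5 ≤ Real.sqrt (2 / 3) ∧ Real.sqrt (2 / 3) ≤ 1 := by
  constructor
  · rw [show (4 / 5 : ℝ) = Real.sqrt ((4 / 5) ^ 2) by rw [Real.sqrt_sq (by norm_num)]]
    exact Real.sqrt_le_sqrt (by norm_num)
  · rw [Real.sqrt_le_one]; norm_num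

/-- **The conclusion of the crux HOLDS for the intended model** whenever its H3 does with equality:
the views of ideal hcp from its two motif points are `hcp` itself and `−hcp` (§10), i.e.
`A(hcpStacking a h)` with `A = ±id`, and `(a, a√⅔) ∈ [1/2, 2]²`. [folklore] -/
theorem hcpPalm_conclusion (h9 : 9 / 10 ≤ a) (h1 : a ≤ 1)
    (hE : (hcpQ (show a ≠ 0 by intro h; rw [h] at h9; norm_num at h9)).energyPerParticle lennardJones = eStar) :
    ∀ᵐ μ ∂(palmLaw (hcpQ (show a ≠ 0 by intro h; rw [h] at h9; norm_num at h9))), IsRelaxedHcp μ := by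
  have ha : a ≠ 0 := by intro h; rw [h] at h9; norm_num at h9
  obtain ⟨hs1, hs2⟩ := sqrt_twoThirds_bounds
  have hbox : 1 / 2 ≤ a * Real.sqrt (2 / 3) ∧ a * Real.sqrt (2 / 3) ≤ 2 := by
    constructor <;> nlinarith
  refine ae_palmLaw _ fun x hx => ?_
  have hpts := hcpQ_points ha
  rcases mem_hcpQ_motif ha hx with rfl | rfl
  · -- view from the A-site 0: hcp itself
    refine ⟨a, a * Real.sqrt (2 / 3), ha, idealRatio_ne_zero ha, by linarith, by linarith, hbox.1, hbox.2,
      LinearIsometryEquiv.refl ℝ E3, hE, ?_⟩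
    unfold viewMeasure view
    congr 1
    rw [hpts]
    ext z
    simp
  · -- view from the B-site b: −hcp
    refine ⟨a, a * Real.sqrt (2 / 3), ha, idealRatio_ne_zero ha, by linarith, by linarith, hbox.1, hbox.2,
      LinearIsometryEquiv.neg ℝ, hE, ?_⟩
    unfold viewMeasure view
    congr 1
    rw [hpts, hcpStacking_sub_b_eq_neg]
    ext z
    simp

/-- **Consistency / non-vacuity modulo the periodic crystal problem.** If ideal hcp at some
admissible spacing `a ∈ [9/10, 1]` MINIMISES the Lennard-Jones energy per particle over periodic
configurations (`e(hcp a (a√⅔)) = e*`), then there is a law satisfying ALL FOUR hypotheses of the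
crux for which the conclusion holds — the intended model. (The crux itself asserts the conclusion for
every such law; this is the sanity check that its intended witness is one.) [folklore] -/
theorem crux_consistent (h9 : 9 / 10 ≤ a) (h1 : a ≤ 1)
    (hE : (hcpQ (show a ≠ 0 by intro h; rw [h] at h9; norm_num at h9)).energyPerParticle lennardJones = eStar) :
    ∃ P : Measure (Measure E3), IsProbabilityMeasure P ∧ Rooted a P ∧ PointStationary P ∧
      meanRootEnergy P ≤ eStar ∧ Layered P ∧ ∀ᵐ μ ∂P, IsRelaxedHcp μ := by
  obtain ⟨h0, hr, h2, h4⟩ := hcpPalm_hypotheses h9 h1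
  exact ⟨_, h0, hr, h2, by rw [hcpPalm_energy_iff]; exact hE.le, h4, hcpPalm_conclusion h9 h1 hE⟩

end IntendedModel

end Summit.AtomisticToContinuum.Crystallization.Theorems.LayeredLawsSelectHcp.Negative.IntendedModel

end
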